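import Mathlib
import Summits.NavierStokesRegularity.NavierStokesRegularity.Theorems.EulerZoomLiouvillePowerGaugeEulerLiouvilleWeakSupportDensityDilation
import HarnessLib

/-!
# Crux `EulerZoomLiouville.PowerGaugeEulerLiouville` (stmt-NavierStokesRegularity-19832), weak stratum, line `weak_eulerian` (ns-idea-11 g9):
# THE SUPPORT-DENSITY BOOTSTRAP — a support law with density-zero support is null (tools for `stub_supportDensityLaw`, E3)

Route №10 `EulerZoomLiouville` (NavierStokesRegularity), crux E = stmt-NavierStokesRegularity-19832; width seat ns-ezl-w1 g8 under the LEAD ns-typeII-p2 g15.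
Pure real analysis on `ℝ³` (sequel of `…WeakSupportDensityDilation`).  `S ⊆ ℝ³` (any set) obeys the support law `∫_S (3γψ + Dψ[W]) = 0` of `W = γy + V`
(`γ > 0`), where `V ∈ L²_loc` has the `A`-gauge growth `∫_{B_L} ‖V‖² ≤ C_A L^{1−2ρ}` (`L ≥ 2`, `ρ > 0`).  With the bump dilates of T1 and
`q(r) = r⁻³∫_S f(r⁻¹y)`:

* `abs_errE_le` — `|E(s)| ≤ M · vol(S ∩ B_{2 rOut s})^{1/2} · (∫_{B_{2 rOut s}} ‖V‖²)^{1/2}` (Cauchy–Schwarz);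
* `tendsto_massF_div_cube` — density `vol(S ∩ B_R)/vol(B_R) → 0` ⇒ `q(R) → 0`;
* `massF_div_cube_le_integral_Ioi` — `q(r) ≤ ∫_r^∞ |E(s)|/(γs⁵) ds` (FTC of T1 + `q(R) → 0`);
* `bootstrap` — `vol(S ∩ B_t) ≤ C₀ t^κ` (`t ≥ t₀ ≥ 1`, `κ ≤ 3`) ⇒ `vol(S ∩ B_r) ≤ C₁ r^{κ/2 − ρ − 1/2}` (`r ≥ t₀`);
* `measure_eq_zero_of_supportLaw_of_density` — **THE SUPPORT-DENSITY LAW (set form)**: `κ : 3 → 1 − ρ → −3ρ/2 < 0`, monotonicity in `r` ⇒ `vol S = 0`.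
[folklore; the Eulerian (DiPerna–Lions) counterpart of Chae 2007 Cor. 1]

WHAT THIS IS NOT: not NS, not E, not E3 — tools; 19832 OPEN.
-/

noncomputable section

-- flat `Theorems/<Route><Decl>…` files of one crux share the namespace of the crux (tree convention)
set_option linter.dupNamespace false

open MeasureTheory Set Filter Topology Metric Function TopologicalSpace
open scoped ENNReal NNReal ContDiff

namespace Summit.NavierStokesRegularity.NavierStokesRegularity.Theorems.PowerGaugeEulerLiouville.WeakEulerian

open Literature.Analysis Literature.Analysis.FunctionSpaces Literature.Analysis.FluidPDE

variable (f : ContDiffBump (0 : EuclideanSpace ℝ (Fin 3)))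
variable {S : Set (EuclideanSpace ℝ (Fin 3))} {V : EuclideanSpace ℝ (Fin 3) → EuclideanSpace ℝ (Fin 3)} {γ ρ CA : ℝ}

/-! ### Cauchy–Schwarz bound of the error functional -/

/-- `∫_{A} ‖V‖ ≤ vol(A)^{1/2} (∫_A ‖V‖²)^{1/2}` for a set of finite volume on which `V ∈ L²`. -/
theorem setIntegral_norm_le_sqrt {A : Set (EuclideanSpace ℝ (Fin 3))} (hA : volume A < ⊤)
    (hV : MemLp V 2 (volume.restrict A)) :
    ∫ y in A, ‖V y‖ ≤ (volume A).toReal ^ (1 / 2 : ℝ) * (∫ y in A, ‖V y‖ ^ 2) ^ (1 / 2 : ℝ) := by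
  haveI : IsFiniteMeasure (volume.restrict A) := isFiniteMeasure_restrict.2 hA.ne
  have h := integral_mul_le_Lp_mul_Lq_of_nonneg (μ := volume.restrict A) Real.HolderConjugate.two_two
    (f := fun _ => (1 : ℝ)) (g := fun y => ‖V y‖) (Eventually.of_forall fun _ => zero_le_one)
    (Eventually.of_forall fun _ => norm_nonneg _) (by simpa using memLp_const (1 : ℝ)) (by simpa using hV.norm)
  simp only [one_mul, Real.one_rpow, integral_const, smul_eq_mul, mul_one] at h
  rw [measureReal_restrict_apply_univ, measureReal_def] at h
  simp only [Real.rpow_two] at h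
  simpa only [one_div] using h

/-- **`|E(s)| ≤ M · vol(S ∩ B(0, 2 rOut s))^{1/2} · (∫_{B(0, 2 rOut s)} ‖V‖²)^{1/2}`** (`s > 0`, `M` = a bound of `‖Df‖`, `V ∈ L²_loc`). -/
theorem abs_errE_le (hV2 : ∀ r : ℝ, MemLp V 2 (volume.restrict (ball (0 : EuclideanSpace ℝ (Fin 3)) r)))
    {M : ℝ} (hM0 : 0 ≤ M) (hM : ∀ z, ‖fderiv ℝ f z‖ ≤ M) {s : ℝ} (hs : 0 < s) :
    |∫ y in S, fderiv ℝ f (s⁻¹ • y) (V y)| ≤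
      M * (volume (S ∩ ball (0 : EuclideanSpace ℝ (Fin 3)) (2 * f.rOut * s))).toReal ^ (1 / 2 : ℝ) *
        (∫ y in ball (0 : EuclideanSpace ℝ (Fin 3)) (2 * f.rOut * s), ‖V y‖ ^ 2) ^ (1 / 2 : ℝ) := by
  set B : Set (EuclideanSpace ℝ (Fin 3)) := ball (0 : EuclideanSpace ℝ (Fin 3)) (2 * f.rOut * s) with hB
  have hO : 0 < f.rOut := f.rOut_pos
  have hBm : MeasurableSet B := measurableSet_ball
  have hBfin : volume B < ⊤ := measure_ball_lt_top
  haveI : IsFiniteMeasure (volume.restrict B) := isFiniteMeasure_restrict.2 hBfin.ne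
  have hVB : IntegrableOn V B volume := (hV2 (2 * f.rOut * s)).integrable one_le_two
  -- pointwise domination by `1_B · M‖V‖`
  have hdom : ∀ y, ‖fderiv ℝ f (s⁻¹ • y) (V y)‖ ≤ B.indicator (fun y => M * ‖V y‖) y := fun y => by
    by_cases hy : f.rOut * s < ‖y‖
    · rw [fderiv_bump_dil_eq_zero f hs hy, zero_apply, norm_zero]
      exact Set.indicator_nonneg (fun z _ => by positivity) y
    · have hyb : y ∈ B := by rw [hB, mem_ball, dist_zero_right]; nlinarith [not_lt.1 hy]
      rw [Set.indicator_of_mem hyb]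
      exact ((fderiv ℝ f (s⁻¹ • y)).le_opNorm (V y)).trans (mul_le_mul_of_nonneg_right (hM _) (norm_nonneg _))
  have hVBM : IntegrableOn (fun y => M * ‖V y‖) B volume := hVB.norm.const_mul M
  have h1 : |∫ y in S, fderiv ℝ f (s⁻¹ • y) (V y)| ≤ ∫ y in S, B.indicator (fun y => M * ‖V y‖) y := by
    rw [← Real.norm_eq_abs]
    exact norm_integral_le_of_norm_le ((hVBM.integrable_indicator hBm).restrict (s := S)) (Eventually.of_forall hdom)
  have h2 : ∫ y in S, B.indicator (fun y => M * ‖V y‖) y = M * ∫ y in B ∩ S, ‖V y‖ := by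
    rw [integral_indicator hBm, Measure.restrict_restrict hBm, integral_const_mul]
  have hAfin : volume (B ∩ S) < ⊤ := lt_of_le_of_lt (measure_mono inter_subset_left) hBfin
  have h3 : ∫ y in B ∩ S, ‖V y‖ ≤ (volume (B ∩ S)).toReal ^ (1 / 2 : ℝ) * (∫ y in B ∩ S, ‖V y‖ ^ 2) ^ (1 / 2 : ℝ) :=
    setIntegral_norm_le_sqrt hAfin ((hV2 _).mono_measure (Measure.restrict_mono inter_subset_left le_rfl))
  have h4 : ∫ y in B ∩ S, ‖V y‖ ^ 2 ≤ ∫ y in B, ‖V y‖ ^ 2 :=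
    setIntegral_mono_set ((hV2 _).integrable_norm_pow two_ne_zero) (Eventually.of_forall fun y => by positivity)
      (Eventually.of_forall inter_subset_left)
  have h5 : (∫ y in B ∩ S, ‖V y‖ ^ 2) ^ (1 / 2 : ℝ) ≤ (∫ y in B, ‖V y‖ ^ 2) ^ (1 / 2 : ℝ) :=
    Real.rpow_le_rpow (integral_nonneg fun y => by positivity) h4 (by norm_num)
  calc |∫ y in S, fderiv ℝ f (s⁻¹ • y) (V y)| ≤ M * ∫ y in B ∩ S, ‖V y‖ := h1.trans h2.le
    _ ≤ M * ((volume (S ∩ B)).toReal ^ (1 / 2 : ℝ) * (∫ y in B, ‖V y‖ ^ 2) ^ (1 / 2 : ℝ)) := by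
        rw [Set.inter_comm S B]
        exact mul_le_mul_of_nonneg_left (h3.trans (mul_le_mul_of_nonneg_left h5 (by positivity))) hM0
    _ = _ := by rw [mul_assoc]

/-! ### The normalised mass tends to zero under density zero -/

/-- `vol(B(0,t)) = vol(B(0,1))·t³`-type identity in `ℝ`: `(vol B(0,t)).toReal = t³ · (4π/3)` for `t ≥ 0`. -/
theorem volume_ball_toReal {t : ℝ} (ht : 0 ≤ t) :
    (volume (ball (0 : EuclideanSpace ℝ (Fin 3)) t)).toReal = t ^ 3 * (Real.pi * 4 / 3) := by
  rw [EuclideanSpace.volume_ball_fin_three, ENNReal.toReal_mul, ENNReal.toReal_pow, ENNReal.toReal_ofReal ht,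
    ENNReal.toReal_ofReal (by positivity)]

/-- **Density zero ⇒ `q(R) = R⁻³∫_S f(R⁻¹y) → 0`**: `∫_S f(R⁻¹y) ≤ vol(S ∩ B_{rOut R}) = density(rOut R) · vol(B_{rOut R})`. -/
theorem tendsto_massF_div_cube
    (hdens : Tendsto (fun R : ℝ => volume (S ∩ ball (0 : EuclideanSpace ℝ (Fin 3)) R) / volume (ball (0 : EuclideanSpace ℝ (Fin 3)) R))
      atTop (𝓝 0)) :
    Tendsto (fun R : ℝ => (∫ y in S, f (R⁻¹ • y)) / R ^ 3) atTop (𝓝 0) := by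
  have hO : 0 < f.rOut := f.rOut_pos
  set d : ℝ → ℝ≥0∞ := fun R => volume (S ∩ ball (0 : EuclideanSpace ℝ (Fin 3)) R) / volume (ball (0 : EuclideanSpace ℝ (Fin 3)) R)
    with hd
  -- `d(rOut R) → 0` in `ℝ`
  have h1 : Tendsto (fun R : ℝ => (d (f.rOut * R)).toReal) atTop (𝓝 0) := by
    have h : Tendsto (fun R : ℝ => d (f.rOut * R)) atTop (𝓝 0) := hdens.comp (tendsto_id.const_mul_atTop hO)
    have h' : Tendsto (fun R : ℝ => (d (f.rOut * R)).toReal) atTop (𝓝 (0 : ℝ≥0∞).toReal) :=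
      (ENNReal.tendsto_toReal ENNReal.zero_ne_top).comp h
    rwa [ENNReal.toReal_zero] at h'
  have h2 : Tendsto (fun R : ℝ => f.rOut ^ 3 * (Real.pi * 4 / 3) * (d (f.rOut * R)).toReal) atTop (𝓝 0) := by
    simpa using h1.const_mul (f.rOut ^ 3 * (Real.pi * 4 / 3))
  refine tendsto_of_tendsto_of_tendsto_of_le_of_le' tendsto_const_nhds h2
    (eventually_of_mem (Ioi_mem_atTop 0) fun R hR => div_nonneg (massF_nonneg f R) (pow_nonneg (le_of_lt hR) 3))
    (eventually_of_mem (Ioi_mem_atTop 0) fun R (hR : 0 < R) => ?_)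
  -- `q(R) ≤ rOut³ (4π/3) d(rOut R)`
  have hb : 0 < f.rOut * R := mul_pos hO hR
  have hvol : volume (ball (0 : EuclideanSpace ℝ (Fin 3)) (f.rOut * R)) ≠ 0 := (measure_ball_pos volume _ hb).ne'
  have hvol' : volume (ball (0 : EuclideanSpace ℝ (Fin 3)) (f.rOut * R)) ≠ ⊤ := measure_ball_lt_top.ne
  have e : (volume (S ∩ ball (0 : EuclideanSpace ℝ (Fin 3)) (f.rOut * R))).toReal =
      (d (f.rOut * R)).toReal * ((f.rOut * R) ^ 3 * (Real.pi * 4 / 3)) := by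
    rw [← volume_ball_toReal hb.le, ← ENNReal.toReal_mul, hd]
    simp only
    rw [ENNReal.div_mul_cancel hvol hvol']
  have hF := massF_le_measure_inter_ball f (S := S) hR
  rw [div_le_iff₀ (pow_pos hR 3)]
  calc ∫ y in S, f (R⁻¹ • y) ≤ (volume (S ∩ ball (0 : EuclideanSpace ℝ (Fin 3)) (f.rOut * R))).toReal := hF
    _ = f.rOut ^ 3 * (Real.pi * 4 / 3) * (d (f.rOut * R)).toReal * R ^ 3 := by rw [e]; ring

/-! ### The normalised mass is controlled by the tail of the error -/

/-- **`q(r) ≤ ∫_r^∞ |E(s)|/(γs⁵) ds`** whenever the right side converges (`r > 0`, `γ > 0`, support law, `q(R) → 0`). -/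
theorem massF_div_cube_le_integral_Ioi (hγ : 0 < γ) (hV : LocallyIntegrable V volume)
    (hlaw : ∀ ψ : EuclideanSpace ℝ (Fin 3) → ℝ, IsTestFunctionOn (⊤ : Opens (EuclideanSpace ℝ (Fin 3))) ψ →
      ∫ y in S, (3 * γ * ψ y + fderiv ℝ ψ y (selfSimilarTransport γ 0 V y)) = 0)
    (hq : Tendsto (fun R : ℝ => (∫ y in S, f (R⁻¹ • y)) / R ^ 3) atTop (𝓝 0))
    {r : ℝ} (hr : 0 < r)
    (hint : IntegrableOn (fun s : ℝ => (∫ y in S, fderiv ℝ f (s⁻¹ • y) (V y)) / (γ * s ^ 5)) (Ioi r) volume) :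
    (∫ y in S, f (r⁻¹ • y)) / r ^ 3 ≤ ∫ s in Ioi r, |(∫ y in S, fderiv ℝ f (s⁻¹ • y) (V y)) / (γ * s ^ 5)| := by
  set I : ℝ := ∫ s in Ioi r, |(∫ y in S, fderiv ℝ f (s⁻¹ • y) (V y)) / (γ * s ^ 5)| with hI
  have hkey : ∀ R : ℝ, r ≤ R → (∫ y in S, f (r⁻¹ • y)) / r ^ 3 ≤ (∫ y in S, f (R⁻¹ • y)) / R ^ 3 + I := by
    intro R hR
    have h := massF_div_cube_sub f (S := S) hγ.ne' hV hlaw hr hR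
    have habs : |∫ s in r..R, (∫ y in S, fderiv ℝ f (s⁻¹ • y) (V y)) / (γ * s ^ 5)| ≤ I := by
      rw [intervalIntegral.integral_of_le hR]
      refine (abs_integral_le_integral_abs).trans ?_
      exact setIntegral_mono_set hint.abs (Eventually.of_forall fun s => abs_nonneg _) (Eventually.of_forall Ioc_subset_Ioi_self)
    have := (abs_le.1 habs).1
    linarith
  refine le_of_tendsto_of_tendsto tendsto_const_nhds (hq.add_const I |>.congr' (Eventually.of_forall fun R => rfl)) ?_ |>.trans (by simp)
  exact eventually_of_mem (Ici_mem_atTop r) fun R hR => hkey R hR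

/-! ### The bootstrap -/

/-- **BOOTSTRAP STEP**: under the standing hypotheses (`γ, ρ > 0`, `S` with the support law and `q(R) → 0`, `V ∈ L²_loc` with growth
`∫_{B_L}‖V‖² ≤ C_A L^{1−2ρ}` for `L ≥ 2`), a volume bound `vol(S ∩ B_t) ≤ C₀ t^κ` for `t ≥ t₀` (`t₀ ≥ 1`, `κ ≤ 3`) improves to
`vol(S ∩ B_r) ≤ C₁ r^{κ/2 − ρ − 1/2}` for `r ≥ t₀`. -/
theorem bootstrap (hγ : 0 < γ) (hρ : 0 < ρ) (hV : LocallyIntegrable V volume)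
    (hV2 : ∀ r : ℝ, MemLp V 2 (volume.restrict (ball (0 : EuclideanSpace ℝ (Fin 3)) r)))
    (hCA : 0 ≤ CA) (hA : ∀ L : ℝ, 2 ≤ L → ∫ y in ball (0 : EuclideanSpace ℝ (Fin 3)) L, ‖V y‖ ^ 2 ≤ CA * L ^ (1 - 2 * ρ))
    (hlaw : ∀ ψ : EuclideanSpace ℝ (Fin 3) → ℝ, IsTestFunctionOn (⊤ : Opens (EuclideanSpace ℝ (Fin 3))) ψ →
      ∫ y in S, (3 * γ * ψ y + fderiv ℝ ψ y (selfSimilarTransport γ 0 V y)) = 0)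
    (hq : Tendsto (fun R : ℝ => (∫ y in S, f (R⁻¹ • y)) / R ^ 3) atTop (𝓝 0)) (hIn : f.rIn = 1)
    {κ C₀ t₀ : ℝ} (hκ : κ ≤ 3) (hC₀ : 0 ≤ C₀) (ht₀ : 1 ≤ t₀)
    (hbound : ∀ t : ℝ, t₀ ≤ t → (volume (S ∩ ball (0 : EuclideanSpace ℝ (Fin 3)) t)).toReal ≤ C₀ * t ^ κ) :
    ∃ C₁ : ℝ, 0 ≤ C₁ ∧ ∀ r : ℝ, t₀ ≤ r →
      (volume (S ∩ ball (0 : EuclideanSpace ℝ (Fin 3)) r)).toReal ≤ C₁ * r ^ (κ / 2 - ρ - 1 / 2) := by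
  obtain ⟨M, hM0, hM⟩ := exists_bound_fderiv_bump f
  have hO : 0 < f.rOut := f.rOut_pos
  have hO1 : 1 < f.rOut := hIn ▸ f.rIn_lt_rOut
  -- exponents
  set a : ℝ := (κ + 1 - 2 * ρ) / 2 with ha
  have ha5 : a - 5 < -1 := by rw [ha]; linarith
  have ha4 : a - 4 < 0 := by linarith
  -- the constant in `|E(s)| ≤ K s^a`
  set K : ℝ := M * (C₀ ^ (1 / 2 : ℝ) * CA ^ (1 / 2 : ℝ)) * (2 * f.rOut) ^ a with hK
  have hK0 : 0 ≤ K := by positivity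
  -- ### the pointwise bound of the error for `s ≥ t₀`
  have hE : ∀ s : ℝ, t₀ ≤ s → |∫ y in S, fderiv ℝ f (s⁻¹ • y) (V y)| ≤ K * s ^ a := by
    intro s hs
    have hs0 : 0 < s := by linarith
    have hL : 2 ≤ 2 * f.rOut * s := by nlinarith
    have hLt : t₀ ≤ 2 * f.rOut * s := by nlinarith
    have h1 := abs_errE_le f (S := S) hV2 hM0 hM hs0
    have h2 : (volume (S ∩ ball (0 : EuclideanSpace ℝ (Fin 3)) (2 * f.rOut * s))).toReal ^ (1 / 2 : ℝ) ≤
        (C₀ * (2 * f.rOut * s) ^ κ) ^ (1 / 2 : ℝ) :=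
      Real.rpow_le_rpow ENNReal.toReal_nonneg (hbound _ hLt) (by norm_num)
    have h3 : (∫ y in ball (0 : EuclideanSpace ℝ (Fin 3)) (2 * f.rOut * s), ‖V y‖ ^ 2) ^ (1 / 2 : ℝ) ≤
        (CA * (2 * f.rOut * s) ^ (1 - 2 * ρ)) ^ (1 / 2 : ℝ) :=
      Real.rpow_le_rpow (integral_nonneg fun y => by positivity) (hA _ hL) (by norm_num)
    have hpos : 0 < 2 * f.rOut * s := by positivity
    have e : (C₀ * (2 * f.rOut * s) ^ κ) ^ (1 / 2 : ℝ) * (CA * (2 * f.rOut * s) ^ (1 - 2 * ρ)) ^ (1 / 2 : ℝ) =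
        (C₀ ^ (1 / 2 : ℝ) * CA ^ (1 / 2 : ℝ)) * (2 * f.rOut) ^ a * s ^ a := by
      rw [Real.mul_rpow hC₀ (by positivity), Real.mul_rpow hCA (by positivity), ← Real.rpow_mul hpos.le, ← Real.rpow_mul hpos.le,
        show κ * (1 / 2 : ℝ) = a - (1 - 2 * ρ) * (1 / 2) by rw [ha]; ring, Real.rpow_sub hpos, Real.mul_rpow (by positivity) hs0.le]
      have h' : (2 * f.rOut * s) ^ ((1 - 2 * ρ) * (1 / 2 : ℝ)) ≠ 0 := (Real.rpow_pos_of_pos hpos _).ne'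
      field_simp
    calc |∫ y in S, fderiv ℝ f (s⁻¹ • y) (V y)|
        ≤ M * (volume (S ∩ ball (0 : EuclideanSpace ℝ (Fin 3)) (2 * f.rOut * s))).toReal ^ (1 / 2 : ℝ) *
            (∫ y in ball (0 : EuclideanSpace ℝ (Fin 3)) (2 * f.rOut * s), ‖V y‖ ^ 2) ^ (1 / 2 : ℝ) := h1
      _ ≤ M * (C₀ * (2 * f.rOut * s) ^ κ) ^ (1 / 2 : ℝ) * (CA * (2 * f.rOut * s) ^ (1 - 2 * ρ)) ^ (1 / 2 : ℝ) :=
          mul_le_mul (mul_le_mul_of_nonneg_left h2 hM0) h3 (by positivity) (by positivity)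
      _ = K * s ^ a := by rw [mul_assoc, e, hK]; ring
  -- ### integrability and size of the tail `∫_r^∞ |E|/(γ s⁵)`
  have htail : ∀ r : ℝ, t₀ ≤ r →
      IntegrableOn (fun s : ℝ => (∫ y in S, fderiv ℝ f (s⁻¹ • y) (V y)) / (γ * s ^ 5)) (Ioi r) volume ∧
        ∫ s in Ioi r, |(∫ y in S, fderiv ℝ f (s⁻¹ • y) (V y)) / (γ * s ^ 5)| ≤ K / γ * (r ^ (a - 4) / (4 - a)) := by
    intro r hr
    have hr0 : 0 < r := by linarith
    have hdom_int : IntegrableOn (fun s : ℝ => K / γ * s ^ (a - 5)) (Ioi r) volume :=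
      (integrableOn_Ioi_rpow_of_lt ha5 hr0).const_mul _
    have hmeas : AEStronglyMeasurable (fun s : ℝ => (∫ y in S, fderiv ℝ f (s⁻¹ • y) (V y)) / (γ * s ^ 5)) (volume.restrict (Ioi r)) := by
      refine ContinuousOn.aestronglyMeasurable (fun s hs => ?_) measurableSet_Ioi
      have hs0 : 0 < s := lt_trans hr0 hs
      exact ((continuousAt_errE f (S := S) hs0 hV).div ((continuousAt_const.mul (continuousAt_pow s 5)))
        (mul_ne_zero hγ.ne' (pow_ne_zero 5 hs0.ne'))).continuousWithinAt
    have hle : ∀ s ∈ Ioi r, ‖(∫ y in S, fderiv ℝ f (s⁻¹ • y) (V y)) / (γ * s ^ 5)‖ ≤ K / γ * s ^ (a - 5) := by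
      intro s hs
      have hs0 : 0 < s := lt_trans hr0 hs
      rw [Real.norm_eq_abs, abs_div, abs_of_pos (by positivity : 0 < γ * s ^ 5), div_le_iff₀ (by positivity)]
      calc |∫ y in S, fderiv ℝ f (s⁻¹ • y) (V y)| ≤ K * s ^ a := hE s (le_trans hr hs.le)
        _ = K / γ * s ^ (a - 5) * (γ * s ^ 5) := by
            rw [Real.rpow_sub hs0, Real.rpow_ofNat]
            field_simp
    have hint : IntegrableOn (fun s : ℝ => (∫ y in S, fderiv ℝ f (s⁻¹ • y) (V y)) / (γ * s ^ 5)) (Ioi r) volume :=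
      Integrable.mono' hdom_int hmeas (eventually_of_mem (self_mem_ae_restrict measurableSet_Ioi) hle)
    refine ⟨hint, ?_⟩
    calc ∫ s in Ioi r, |(∫ y in S, fderiv ℝ f (s⁻¹ • y) (V y)) / (γ * s ^ 5)|
        ≤ ∫ s in Ioi r, K / γ * s ^ (a - 5) :=
          setIntegral_mono_on hint.abs hdom_int measurableSet_Ioi fun s hs => by rw [← Real.norm_eq_abs]; exact hle s hs
      _ = K / γ * (r ^ (a - 4) / (4 - a)) := by
          rw [integral_const_mul, integral_Ioi_rpow_of_lt ha5 hr0, show a - 5 + 1 = a - 4 by ring]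
          congr 1
          rw [neg_div, ← div_neg, neg_sub]
  -- ### conclusion
  refine ⟨K / γ / (4 - a), div_nonneg (div_nonneg hK0 hγ.le) (by linarith), fun r hr => ?_⟩
  have hr0 : 0 < r := by linarith
  obtain ⟨hint, hI⟩ := htail r hr
  have hq1 := massF_div_cube_le_integral_Ioi f (S := S) hγ hV hlaw hq hr0 hint
  have hmass := measure_inter_closedBall_le_massF f (S := S) hr0
  rw [hIn, one_mul] at hmass
  have hball : (volume (S ∩ ball (0 : EuclideanSpace ℝ (Fin 3)) r)).toReal ≤
      (volume (S ∩ closedBall (0 : EuclideanSpace ℝ (Fin 3)) r)).toReal :=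
    ENNReal.toReal_mono (lt_of_le_of_lt (measure_mono inter_subset_right) measure_closedBall_lt_top).ne
      (measure_mono (inter_subset_inter_right _ ball_subset_closedBall))
  have hF : ∫ y in S, f (r⁻¹ • y) ≤ r ^ 3 * (K / γ * (r ^ (a - 4) / (4 - a))) := by
    have := (div_le_iff₀ (pow_pos hr0 3)).1 (hq1.trans hI)
    linarith
  have e : r ^ 3 * (K / γ * (r ^ (a - 4) / (4 - a))) = K / γ / (4 - a) * r ^ (κ / 2 - ρ - 1 / 2) := by
    have h' : κ / 2 - ρ - 1 / 2 = (a - 4) + 3 := by rw [ha]; ring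
    rw [h', Real.rpow_add hr0, Real.rpow_ofNat]
    field_simp
  linarith [hmass, hball, hF, e.le, e.ge]

/-! ### The support-density law, set form -/

/-- **THE SUPPORT-DENSITY LAW (set form).**  `γ, ρ > 0`; `V ∈ L²_loc(ℝ³)` with `∫_{B_L}‖V‖² ≤ C_A L^{1−2ρ}` for `L ≥ 2`; `S` (any set; set integrals are over `volume.restrict S`) with the
support law `∫_S (3γψ + Dψ[γy + V]) = 0` for all test `ψ` and support density `vol(S ∩ B_R)/vol(B_R) → 0`.  Then `vol S = 0`
(bootstrap `κ : 3 → 1 − ρ → −3ρ/2`, then monotonicity in the radius). -/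
theorem measure_eq_zero_of_supportLaw_of_density (hγ : 0 < γ) (hρ : 0 < ρ) (hV : LocallyIntegrable V volume)
    (hV2 : ∀ r : ℝ, MemLp V 2 (volume.restrict (ball (0 : EuclideanSpace ℝ (Fin 3)) r)))
    (hCA : 0 ≤ CA) (hA : ∀ L : ℝ, 2 ≤ L → ∫ y in ball (0 : EuclideanSpace ℝ (Fin 3)) L, ‖V y‖ ^ 2 ≤ CA * L ^ (1 - 2 * ρ))
    (hlaw : ∀ ψ : EuclideanSpace ℝ (Fin 3) → ℝ, IsTestFunctionOn (⊤ : Opens (EuclideanSpace ℝ (Fin 3))) ψ →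
      ∫ y in S, (3 * γ * ψ y + fderiv ℝ ψ y (selfSimilarTransport γ 0 V y)) = 0)
    (hdens : Tendsto (fun R : ℝ => volume (S ∩ ball (0 : EuclideanSpace ℝ (Fin 3)) R) / volume (ball (0 : EuclideanSpace ℝ (Fin 3)) R))
      atTop (𝓝 0)) :
    volume S = 0 := by
  -- the bump with `rIn = 1`, `rOut = 2`
  set f₀ : ContDiffBump (0 : EuclideanSpace ℝ (Fin 3)) := ⟨1, 2, one_pos, one_lt_two⟩ with hf₀
  have hIn : f₀.rIn = 1 := rfl
  have hq := tendsto_massF_div_cube f₀ (S := S) hdens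
  -- κ₀ = 3
  have h0 : ∀ t : ℝ, 1 ≤ t → (volume (S ∩ ball (0 : EuclideanSpace ℝ (Fin 3)) t)).toReal ≤ Real.pi * 4 / 3 * t ^ (3 : ℝ) := by
    intro t ht
    have ht0 : 0 ≤ t := by linarith
    calc (volume (S ∩ ball (0 : EuclideanSpace ℝ (Fin 3)) t)).toReal ≤ (volume (ball (0 : EuclideanSpace ℝ (Fin 3)) t)).toReal :=
          ENNReal.toReal_mono measure_ball_lt_top.ne (measure_mono inter_subset_right)
      _ = Real.pi * 4 / 3 * t ^ (3 : ℝ) := by rw [volume_ball_toReal ht0, Real.rpow_ofNat]; ring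
  obtain ⟨C₁, hC₁, h1⟩ := bootstrap f₀ hγ hρ hV hV2 hCA hA hlaw hq hIn (le_refl (3 : ℝ)) (by positivity) le_rfl h0
  have hκ₁ : (3 : ℝ) / 2 - ρ - 1 / 2 ≤ 3 := by linarith
  obtain ⟨C₂, hC₂, h2⟩ := bootstrap f₀ hγ hρ hV hV2 hCA hA hlaw hq hIn hκ₁ hC₁ le_rfl h1
  have hneg : ((3 : ℝ) / 2 - ρ - 1 / 2) / 2 - ρ - 1 / 2 = -(3 * ρ / 2) := by ring
  rw [hneg] at h2
  -- ### every ball is null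
  have hball : ∀ r₁ : ℝ, 1 ≤ r₁ → volume (S ∩ ball (0 : EuclideanSpace ℝ (Fin 3)) r₁) = 0 := by
    intro r₁ hr₁
    have hfin : volume (S ∩ ball (0 : EuclideanSpace ℝ (Fin 3)) r₁) ≠ ⊤ :=
      (lt_of_le_of_lt (measure_mono inter_subset_right) measure_ball_lt_top).ne
    -- `vol(S ∩ B_{r₁}) ≤ C₂ r^{−3ρ/2}` for every `r ≥ r₁`, and the right side tends to `0`
    have hlim : Tendsto (fun r : ℝ => C₂ * r ^ (-(3 * ρ / 2))) atTop (𝓝 0) := by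
      have h := (tendsto_rpow_neg_atTop (by positivity : 0 < 3 * ρ / 2)).const_mul C₂
      simpa using h
    have hle : (volume (S ∩ ball (0 : EuclideanSpace ℝ (Fin 3)) r₁)).toReal ≤ 0 := by
      refine le_of_tendsto_of_tendsto tendsto_const_nhds hlim (eventually_of_mem (Ici_mem_atTop r₁) fun r (hr : r₁ ≤ r) => ?_)
      calc (volume (S ∩ ball (0 : EuclideanSpace ℝ (Fin 3)) r₁)).toReal ≤ (volume (S ∩ ball (0 : EuclideanSpace ℝ (Fin 3)) r)).toReal :=
            ENNReal.toReal_mono (lt_of_le_of_lt (measure_mono inter_subset_right) measure_ball_lt_top).ne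
              (measure_mono (inter_subset_inter_right _ (ball_subset_ball hr)))
        _ ≤ C₂ * r ^ (-(3 * ρ / 2)) := h2 r (le_trans hr₁ hr)
    have h0 : (volume (S ∩ ball (0 : EuclideanSpace ℝ (Fin 3)) r₁)).toReal = 0 := le_antisymm hle ENNReal.toReal_nonneg
    exact ((ENNReal.toReal_eq_zero_iff _).1 h0).resolve_right hfin
  -- ### `S = ⋃ₙ S ∩ B_{n+1}`
  have hcover : S ⊆ ⋃ n : ℕ, S ∩ ball (0 : EuclideanSpace ℝ (Fin 3)) ((n : ℝ) + 1) := by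
    intro y hy
    obtain ⟨n, hn⟩ := exists_nat_gt ‖y‖
    exact mem_iUnion.2 ⟨n, hy, by rw [mem_ball, dist_zero_right]; linarith⟩
  refine measure_mono_null hcover (measure_iUnion_null fun n => hball _ ?_)
  have : (0 : ℝ) ≤ n := n.cast_nonneg
  linarith

end Summit.NavierStokesRegularity.NavierStokesRegularity.Theorems.PowerGaugeEulerLiouville.WeakEulerian

end
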